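import Mathlib
import Literature.NumberTheory.EllipticCurves.HeegnerPointsOfConductor
import Literature.NumberTheory.EllipticCurves.HeegnerPointsKolyvaginTorsionProofs
import Literature.NumberTheory.EllipticCurves.NonEisensteinPrimeOfSurjective
import Literature.NumberTheory.EllipticCurves.ModularityVersionApProofs
import Literature.NumberTheory.EllipticCurves.Selmer
import Literature.NumberTheory.EllipticCurves.QuadraticTwist
import HarnessLib
import Literature.NumberTheory.EllipticCurves.BSDSelmerPConverseRamifiedProofs
import Literature.NumberTheory.EllipticCurves.BSDSelmerPConverseSerreProofs

/-!
# HeegnerPointsKolyvaginStructure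

Topic `Literature/NumberTheory/EllipticCurves`. Named literature fact(s) relocated by the gate from `Summits/BirchSwinnertonDyer/BirchSwinnertonDyer/Theorems/SelmerRankSelmerRankLBStubKolyvaginStructure.lean`
(accept-time relocation of `[cite]`d propositions written inline in a Summits proposal; human ruling 2026-08-15).
Sources: BurungaleEtAl2026, GrossLMS1991, Kolyvagin1991MathAnn, WZhang2014.

* `Literature.NumberTheory.EllipticCurves.BurungaleEtAl2026_exists_kolyvaginClass_ne_zero`
* `Literature.NumberTheory.EllipticCurves.Kolyvagin1991_selmerCorank_of_kolyvaginClass_ne_zero`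
-/

namespace Literature.NumberTheory.EllipticCurves

open scoped Classical
open Literature.NumberTheory.EllipticCurves.ModularForms WeierstrassCurve

/-- **Burungale–Castella–Grossi–Skinner 2026, Thm. 1 — the Heegner-point Kolyvagin system does not
vanish (the non-vanishing `κ^∞ ≠ 0` posed by Kolyvagin in 1991, a THEOREM of the source)**
(Camb. J. Math. 14 (2026) = arXiv:2312.09301, §0.1: "THEOREM 1 […]. Let `E/ℚ` be an elliptic
curve, and let `p` be an odd prime of good ordinary reduction for `E`. Let `K` be a quadratic
imaginary field satisfying (Heeg) [every prime `ℓ | N` splits in `K`], (disc) [`D_K` is odd and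
`D_K ≠ −3`], (tor) [`E(K)[p] = 0`], and such that `p` splits in `K`. Assume that [the rational
anticyclotomic characteristic-ideal identity (conj:anticyc) of the paper] holds. Then there exists
`n ∈ 𝒩_{Heeg}` such that `κ_n^{Heeg} ≠ 0`. In particular, `{κ_n^{Heeg}} ≠ 0` in both of the
following cases: … ∘ `p > 3` satisfies (irr) [`E[p]` is an irreducible `G_ℚ`-module]" — the second
case being unconditional, the anticyclotomic identity being supplied there by the paper's
references; `𝒩_{Heeg}` the square-free products of Kolyvagin primes — `ℓ` inert,
prime to `Np`, `M(ℓ) = min{ord_p(ℓ+1), ord_p(a_ℓ)} > 0` —, `M(n) = min_{ℓ∣n} M(ℓ)`, `M(1) = ∞`,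
`κ_n^{Heeg} ∈ H¹(K, T/p^{M(n)}T)` the descent of the Kummer image of
`κ̃_n = Σ_{σ∈S} σ D_n(P[n])`, `D_ℓ = Σ_{i=1}^{ℓ} iσ_ℓ^i`, §1.1.2).
In the tree's vocabulary (file `HeegnerPointsOfConductor`): for `W/ℚ` globally minimal elliptic,
`p > 3` a prime of good ORDINARY reduction (`p ∤ a_p`) with `E[p]` irreducible, `K` imaginary
quadratic with the Heegner hypothesis for `N_E = W.conductorNorm ℤ`, `d_K` odd, `d_K ≠ −3`,
`E(K)[p] = 0` and `p` split in `K`, THERE EXIST a modular parametrisation datum `Dt` of level `N_E`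
(the paper's fixed `π`; modularity), an orientation `β`, `β² ≡ d_K (mod 4N_E)` (the paper's `𝔑`),
an embedding `ι : K → ℂ`, a square-free product `n` of Kolyvagin primes
(`KolyvaginDescent.KolSupp (Zhang2014.IsKolyvaginPrime N_E W K p) n`), a Kolyvagin–Heegner datum `d`
of conductor `n` (the `K[n]`-rational point `y(n) = π(x_n)` — CM theory, Gross 1991 §3, assumed by
the paper and not proved in the tree —, generators `σ_ℓ`, representatives `S`, an embedding
`K[n] → K̄`) and a level `1 ≤ M ≤ M(n)` (`Zhang2014.levelIndex`) such that Kolyvagin's class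
`c_M(n) = d.kolyvaginClass _ M ∈ H¹(K, E[p^M])` (McCallum's cocycle of
`P(n) = Σ_{σ∈S} σ D_n y(n)`; genuine, not the junk value, whenever non-zero:
`KolyvaginHeegnerData.kolyvaginClass_ne_zero`) is NON-ZERO. (For `n > 1` take `M = M(n)`, where
`c_{M(n)}(n) = κ_n^{Heeg}`; for `n = 1`, `κ_1^{Heeg} ∈ H¹(K, T) = lim_M H¹(K, E[p^M])` is the Kummer
image of `P_K` and is non-zero iff some `c_M(1)`, `M ≥ 1`, is.) Size XL (anticyclotomic Iwasawa
theory: Cornut–Vatsal, the BDP explicit reciprocity law, Howard's Kolyvagin-system bound with error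
terms, the rational anticyclotomic characteristic-ideal identity of Burungale–Castella–Skinner);
no `_holds`.
[cite: BurungaleEtAl2026, Thm. 1 (arXiv:2312.09301, §0.1, pp. 3–4) and §1.1.2]
[cite: GrossLMS1991, §3 and §4 (4.1), (4.4)]
[file NumberTheory/EllipticCurves/HeegnerPointsKolyvaginStructure] -/
def BurungaleEtAl2026_exists_kolyvaginClass_ne_zero : Prop :=
  ∀ (W : WeierstrassCurve ℚ) [W.IsElliptic] [W.IsGloballyMinimal] (p : ℕ) [hp : Fact p.Prime],
    3 < p → W.HasGoodReductionAtPrime p → ¬ (p : ℤ) ∣ W.frobeniusTrace p →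
    W.HasIrreducibleModPGaloisRep p →
    ∀ (K : Type) [Field K] [NumberField K], IsImaginaryQuadratic K →
      ∀ [NeZero (W.conductorNorm ℤ)], SatisfiesHeegnerHypothesis (W.conductorNorm ℤ) K →
      Odd (NumberField.discr K) → NumberField.discr K ≠ -3 →
      AddSubgroup.torsionBy (W.baseChange K).toAffine.Point (p : ℤ) = ⊥ →
      SatisfiesHeegnerHypothesis p K →
      ∃ (Dt : ModularParametrizationData W (W.conductorNorm ℤ)) (β : ℤ) (ι : K →+* ℂ) (n : ℕ)
        (d : KolyvaginHeegnerData Dt β ι n) (M : ℕ),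
        KolyvaginDescent.KolSupp (Zhang2014.IsKolyvaginPrime (W.conductorNorm ℤ) W K p) n ∧
          1 ≤ M ∧ (M : ℕ∞) ≤ Zhang2014.levelIndex W p n ∧ d.kolyvaginClass hp.out M ≠ 0

/-- **Kolyvagin 1991, Thm. 4 — the structure theorem: the order of vanishing of the Heegner-point
Kolyvagin system reads the Selmer coranks** (V. A. Kolyvagin, *On the structure of Selmer groups*,
Math. Ann. 291 (1991) 253–259, §2: "THEOREM [4; 2.3 in the typescript]. Suppose [statement 1.1 of
§1: `T = {τ_{λ,n}} ≠ {0}`] is true. Then `r^{(f+1)} = f + 1`, `r^{(f)} ≤ f`, and `f − r^{(f)}` is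
even", where `f` is the least `r` such that some `τ_{λ,n}`, `λ ∈ Λ^r`, `1 ≤ n ≤ n(λ)`, is
non-zero, `(i) ∈ {0, 1}` is `i mod 2`,
and `r^ν` is the `ℤ_ℓ`-corank of `S^ν = lim_n S^ν_{ℓ^n}`, the `ν`-part of the Selmer group of `E`
over `K` under `Gal(K/ℚ)`, about which the paragraph before the theorem says: "The group `S^ν_{ℓ^n}`
coincides with the maximal `ℓ^n`-torsion subgroup of `S^ν` and with the Selmer group of level `ℓ^n`
for `E^ν` over `ℚ`. Here `E^ν` is `E` if `(−1)^{ν+1}ε = 1`, and `E^ν` is the form of `E` over `K`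
otherwise" (`ε = (−1)^{g−1}`, `g = ord_{s=1} L(E, s)`). Setting (§1): `K = ℚ(√D)`,
`0 > D ≡ □ (mod 4N)`, `D ≠ −3, −4`; `ℓ ∈ B(E)`: odd with `G_ℚ → Aut(T_ℓ E)` onto; Kolyvagin primes
`p ∤ N` inert in `K` with `n(p) = ord_ℓ(p+1, a_p) ≥ 1`; `τ_{λ,n} ∈ H¹(K, E_{ℓ^n})` the class with
`res τ_{λ,n} = P_λ (mod ℓ^n E(K_λ))`, `P_λ = J_λ I_λ y_λ`. Restated by W. Zhang, Camb. J. Math. 2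
(2014), Thm. 11.2 (i) (p. 248; = Thm. 1.2, p. 195, with BCGS 2026 Cor. 1): "`(p, DN) = 1` and `N⁻`
square-free with even number of factors [here `N⁻ = 1`: the Heegner hypothesis]; `ρ̄_{E,p}`
surjective [`p ≥ 5`]. Assume that `M_∞` is finite and denote by `ν_∞` the vanishing order of `κ^∞`
[the minimal number of prime factors of `n ∈ Λ` such that `c_M(n) ≠ 0` for some `M ≤ M(n)`]. Then
`r_p^{ε_{ν_∞}}(E/K) = ν_∞ + 1` and `0 ≤ ν_∞ − r_p^{−ε_{ν_∞}}(E/K) ≡ 0 mod 2`",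
`ε_ν = ε(E/ℚ)(−1)^{ν+1}`.)
In the tree's vocabulary: let `W/ℚ` be globally minimal elliptic, `p ≥ 5` a prime with `ρ̄_{E,p}`
surjective (so `p ∈ B(E)`, Serre), `K` imaginary quadratic with `d_K ≠ −3, −4`, `p ∤ d_K N_E`, and
the Heegner hypothesis for `N_E = W.conductorNorm ℤ` (so `d_K ≡ □ (mod 4N_E)`); fix a
parametrisation datum `Dt`, an orientation `β` and `ι : K → ℂ` (the sources' fixed `γ`, `i_1`,
`K ⊂ ℂ`). Suppose `c_M(n) ≠ 0` (`KolyvaginHeegnerData.kolyvaginClass`) for a square-free product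
`n` of Kolyvagin primes (`KolyvaginDescent.KolSupp (Zhang2014.IsKolyvaginPrime N_E W K p) n`), a
datum `d` of conductor `n` and a level `1 ≤ M ≤ M(n)` — the non-vanishing hypothesis `T ≠ {0}`
of the theorem — and that
`ν(n) = #{ℓ ∣ n}` is MINIMAL among all such non-zero classes `c_{M'}(n')` of the same system
(`ν(n) = f = ord κ^∞`; the vanishing of `c_M(n)` does not depend on the choices `σ_ℓ`, `S`,
`K[n] → K̄` inside the datum). Then, with `c = corank_{ℤ_p} Sel_{p^∞}(E/ℚ)` and
`c' = corank_{ℤ_p} Sel_{p^∞}(E^{(d_K)}/ℚ)` (`WeierstrassCurve.selmerCorank` of `W` and of the twist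
`W.quadraticTwist d_K` = "the form of `E` over `K`"): EITHER `c = ν(n) + 1`, `c' ≤ ν(n)` and
`ν(n) − c'` is even, OR `c' = ν(n) + 1`, `c ≤ ν(n)` and `ν(n) − c` is even. Weaker than print: which
alternative holds (decided by `ε = (−1)^{g−1}`, resp. by the root number in Zhang's form, the
`+`-eigenspace being `Sel(E/ℚ)` and the `−`-eigenspace `Sel(E^K/ℚ)` for odd `p`) is forgotten.
Size XL (Kolyvagin's theory of the classes `τ_{λ,n}`: Euler-system relations, Čebotarev choice of
primes, global duality and the Cassels pairing); no `_holds`.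
[cite: Kolyvagin1991MathAnn, §2 Thm. 4 (= Thm. 2.3 of the typescript) with the paragraph before it]
[cite: Kolyvagin1991MathAnn, §1, statement 1.1 of the typescript (T ≠ {0})]
[cite: WZhang2014, Thm. 11.2 (i) (p. 248), Thm. 1.2 (p. 195), p. 194 (Λ, M(n), κ^∞, ord)]
[cite: BurungaleEtAl2026, Cor. 1 (arXiv:2312.09301, §0.1, p. 4)]
[file NumberTheory/EllipticCurves/HeegnerPointsKolyvaginStructure] -/
def Kolyvagin1991_selmerCorank_of_kolyvaginClass_ne_zero : Prop :=
  ∀ (W : WeierstrassCurve ℚ) [W.IsElliptic] [W.IsGloballyMinimal] (p : ℕ) [hp : Fact p.Prime],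
    5 ≤ p → W.HasSurjectiveModNGaloisRep p →
    ∀ (K : Type) [Field K] [NumberField K], IsImaginaryQuadratic K →
      NumberField.discr K ≠ -3 → NumberField.discr K ≠ -4 →
      ¬ ((p : ℤ) ∣ NumberField.discr K) → ¬ (p ∣ W.conductorNorm ℤ) →
      ∀ [NeZero (W.conductorNorm ℤ)], SatisfiesHeegnerHypothesis (W.conductorNorm ℤ) K →
      ∀ (Dt : ModularParametrizationData W (W.conductorNorm ℤ)) (β : ℤ) (ι : K →+* ℂ) (n : ℕ)
        (d : KolyvaginHeegnerData Dt β ι n) (M : ℕ),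
        KolyvaginDescent.KolSupp (Zhang2014.IsKolyvaginPrime (W.conductorNorm ℤ) W K p) n →
        1 ≤ M → (M : ℕ∞) ≤ Zhang2014.levelIndex W p n → d.kolyvaginClass hp.out M ≠ 0 →
        (∀ (n' : ℕ) (d' : KolyvaginHeegnerData Dt β ι n') (M' : ℕ),
          KolyvaginDescent.KolSupp (Zhang2014.IsKolyvaginPrime (W.conductorNorm ℤ) W K p) n' →
          1 ≤ M' → (M' : ℕ∞) ≤ Zhang2014.levelIndex W p n' → d'.kolyvaginClass hp.out M' ≠ 0 →
          n.primeFactors.card ≤ n'.primeFactors.card) →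
        (W.selmerCorank p = n.primeFactors.card + 1 ∧
            (W.quadraticTwist (NumberField.discr K : ℚ)).selmerCorank p ≤ n.primeFactors.card ∧
            Even (n.primeFactors.card -
              (W.quadraticTwist (NumberField.discr K : ℚ)).selmerCorank p)) ∨
          ((W.quadraticTwist (NumberField.discr K : ℚ)).selmerCorank p = n.primeFactors.card + 1 ∧
            W.selmerCorank p ≤ n.primeFactors.card ∧
            Even (n.primeFactors.card - W.selmerCorank p))

end Literature.NumberTheory.EllipticCurves

/-! ## Relocated from `Summits/BirchSwinnertonDyer/BirchSwinnertonDyer/Theorems/KolyvaginDepthDoorDepthTableOddPrimeKit.lean` (gate, accept-time relocation of cited facts) — Kolyvagin1991MathAnn, McCallumLMS1991, WZhang2014 -/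

namespace Literature.NumberTheory.EllipticCurves

open scoped Classical NumberField
open Literature.NumberTheory.EllipticCurves.ModularForms WeierstrassCurve

/-- **Kolyvagin 1991, Thm. 4 (Thm. 2.3 of the typescript) — the structure theorem at ANY prime `ℓ ∈ B(E)` (printed form: `ℓ`
odd, `ρ_{E,ℓ^∞}` surjective)** (V. A. Kolyvagin, *On the structure of Selmer groups*, Math. Ann. 291
(1991) 253–259). §1, p. 254, verbatim: *"Let `O` be `End(E)`, `Q = O ⊗ ℚ`. Let `ℓ` be a rational
prime, `T = lim E_{ℓ^n}` be the Tate-module and `Ô = O ⊗ ℤ_ℓ`. We let `B(E)` denote the set of odd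
rational primes which do not divide the discriminant of `O` and for which the natural representation
`ρ : G(ℚ̄/ℚ) → Aut_O T` is surjective. It is known (from the theory of complex multiplication and
Serre's theory, resp.) that almost all (all but a finite number of) primes belong to `B(E)`. …
We fix a prime `ℓ ∈ B(E)`."* (setting of §1, pp. 253–254: `E/ℚ` modular with a parametrisation
`γ : X₀(N) → E`; `K = ℚ(√D)`, `0 > D ≡ □ (mod 4N)`, `D ≠ −3, −4`; Kolyvagin primes `p ∤ N` inert in
`K` with `n(p) = ord_ℓ(p + 1, a_p) ≥ 1`; `Λ^r` the products of `r` distinct such primes; classes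
`τ_{λ,n} ∈ H¹(K, E_M)`, `M = ℓⁿ`, `1 ≤ n ≤ n(λ)`, with `res τ_{λ,n} = P_λ (mod M E(K_λ))`,
`P_λ = J_λ I_λ y_λ`; p. 255, statement 1.1 of §1: `T ≠ {0}` (the non-vanishing HYPOTHESIS of the theorem, here
the hypothesis `c_M(n) ≠ 0`), and *"Let `f` be the minimal `r` such that `m_r < ∞`"*.) §2, p. 258, verbatim (typescript numbering; the printed theorem is Thm. 4): *"The group `S^ν = lim S_{ℓ^n}` is isomorphic to a direct sum
of `(ℚ_ℓ/ℤ_ℓ)^{r^ν}` and a finite group `X^ν`. The group `S^ν_{ℓ^n}` coincides with the maximal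
`ℓ^n`-torsion subgroup of `S^ν` and with the Selmer group of level `ℓ^n` for `E^ν` over `ℚ`. Here
`E^ν` is `E` if `(−1)^{ν+1}ε = 1`, and `E^ν` is the form of `E` over `K` otherwise. … **Theorem 2.3.**
Suppose [statement 1.1 of §1: `T ≠ {0}`] is true. Then `r^{(f+1)} = f + 1`, `r^{(f)} ≤ f`, and `f − r^{(f)} is
even."* (`(i) ∈ {0,1}` the parity of `i`; `ε = (−1)^{g−1}`, `g = ord_{s=1} L(E, s)`.) This is the
theorem the tree's `Kolyvagin1991_selmerCorank_of_kolyvaginClass_ne_zero` transcribes in W. Zhang's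
RESTATEMENT (Camb. J. Math. 2 (2014), Thm. 11.2 (i): `p ≥ 5`, `ρ̄_{E,p}` surjective, `(p, DN) = 1`);
the present `def` transcribes the PRINTED hypothesis on the prime instead — `p` odd and
`G_ℚ → Aut(T_p E) ≅ GL₂(ℤ_p)` onto, spelled `∀ m, ρ̄_{E,p^m}` onto
(`W.HasSurjectiveModNGaloisRep (p ^ m)`, the tree's spelling of `p`-adic surjectivity, as in
`McCallum1991_card_sha_primary_of_derivedPoint_not_divisible`; it forces `End(E) = ℤ`, so
`disc O = 1`) — and keeps EVERYTHING ELSE VERBATIM from the sibling (same data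
`KolyvaginHeegnerData`, same classes `kolyvaginClass`, same Kolyvagin primes
`Zhang2014.IsKolyvaginPrime`, same levels `levelIndex`, Zhang's `(p, D N) = 1` kept as the extra
hypotheses `p ∤ d_K`, `p ∤ N_E`, same weaker-than-print dichotomy forgetting which eigenspace is
which). For `p ≥ 5` the sibling FOLLOWS from this `def` by Serre's lifting lemma (tree theorem
`serre_hasSurjectiveModNGaloisRep_pow_holds`): see
`Summit.….KolyvaginDepthDoor.kolyvagin1991_of_padicSurj`. In the tree's vocabulary: `W/ℚ` globally
minimal elliptic; `p` an odd prime with `ρ̄_{E,p^m}` onto for every `m`; `K` imaginary quadratic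
with `d_K ≠ −3, −4`, `p ∤ d_K N_E`, and the Heegner hypothesis for `N_E = W.conductorNorm ℤ`; a
parametrisation datum `Dt`, an orientation `β`, `ι : K → ℂ`; if `c_M(n) ≠ 0` for a square-free
product `n` of Kolyvagin primes, a datum `d` of conductor `n` and `1 ≤ M ≤ M(n)`, with `ν(n) = #{ℓ ∣ n}`
minimal among all non-zero classes of the system, then with `c = corank_{ℤ_p} Sel_{p^∞}(E/ℚ)`,
`c' = corank_{ℤ_p} Sel_{p^∞}(E^{(d_K)}/ℚ)`: EITHER `c = ν(n) + 1`, `c' ≤ ν(n)`, `ν(n) − c'` even, OR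
`c' = ν(n) + 1`, `c ≤ ν(n)`, `ν(n) − c` even. Weaker than print (the eigenspace dictionary is
forgotten; extra coprimality hypotheses); never stronger. Size XL (Kolyvagin's Euler-system
relations, Čebotarev choice of primes, global duality, the Cassels pairing); no `_holds`.
[cite: Kolyvagin1991MathAnn, §1 (B(E), p. 254; T, τ_{λ,n}, statement 1.1, f, pp. 254–255)]
[cite: Kolyvagin1991MathAnn, §2 Thm. 4 (= Thm. 2.3 of the typescript) with the paragraph before it (p. 258)]
[cite: WZhang2014, Thm. 11.2 (i) (p. 248)]
[cite: McCallumLMS1991, §3 (p. 298: the image hypothesis on the p^M-division fields)]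
[file NumberTheory/EllipticCurves/HeegnerPointsKolyvaginStructure] -/
def Kolyvagin1991_selmerCorank_of_kolyvaginClass_ne_zero_of_padicSurj : Prop :=
  ∀ (W : WeierstrassCurve ℚ) [W.IsElliptic] [W.IsGloballyMinimal] (p : ℕ) [hp : Fact p.Prime],
    p ≠ 2 → (∀ m : ℕ, W.HasSurjectiveModNGaloisRep (p ^ m : ℕ)) →
    ∀ (K : Type) [Field K] [NumberField K], IsImaginaryQuadratic K →
      NumberField.discr K ≠ -3 → NumberField.discr K ≠ -4 →
      ¬ ((p : ℤ) ∣ NumberField.discr K) → ¬ (p ∣ W.conductorNorm ℤ) →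
      ∀ [NeZero (W.conductorNorm ℤ)], SatisfiesHeegnerHypothesis (W.conductorNorm ℤ) K →
      ∀ (Dt : ModularParametrizationData W (W.conductorNorm ℤ)) (β : ℤ) (ι : K →+* ℂ) (n : ℕ)
        (d : KolyvaginHeegnerData Dt β ι n) (M : ℕ),
        KolyvaginDescent.KolSupp (Zhang2014.IsKolyvaginPrime (W.conductorNorm ℤ) W K p) n →
        1 ≤ M → (M : ℕ∞) ≤ Zhang2014.levelIndex W p n → d.kolyvaginClass hp.out M ≠ 0 →
        (∀ (n' : ℕ) (d' : KolyvaginHeegnerData Dt β ι n') (M' : ℕ),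
          KolyvaginDescent.KolSupp (Zhang2014.IsKolyvaginPrime (W.conductorNorm ℤ) W K p) n' →
          1 ≤ M' → (M' : ℕ∞) ≤ Zhang2014.levelIndex W p n' → d'.kolyvaginClass hp.out M' ≠ 0 →
          n.primeFactors.card ≤ n'.primeFactors.card) →
        (W.selmerCorank p = n.primeFactors.card + 1 ∧
            (W.quadraticTwist (NumberField.discr K : ℚ)).selmerCorank p ≤ n.primeFactors.card ∧
            Even (n.primeFactors.card -
              (W.quadraticTwist (NumberField.discr K : ℚ)).selmerCorank p)) ∨
          ((W.quadraticTwist (NumberField.discr K : ℚ)).selmerCorank p = n.primeFactors.card + 1 ∧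
            W.selmerCorank p ≤ n.primeFactors.card ∧
            Even (n.primeFactors.card - W.selmerCorank p))

end Literature.NumberTheory.EllipticCurves
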